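import Literature.Geometry.Riemannian.VolumeSphereTheoremGHDecompositionProofs
import Literature.Geometry.Riemannian.BishopGromovVolumeComparison
import HarnessLib

/-!
# `ε`-approximations to the round sphere extend from dense subsets

The last step of the Gromov–Hausdorff assembly in Colding's proof of the volume sphere theorem
(`Colding1996_volume_ghClose`; Colding 1996, §2, and Colding 1997, *Aspects*, proof of Thm. 2.2,
pp. 114–115): the comparison map `M → Sⁿ` is shown to be an `ε`-approximation only on the "good"
set `G ⊆ M`, the complement of a set of small measure; `G` is `η`-dense by relative volume
comparison (Bishop–Gromov, `BishopGromovVolumeComparison.lean`), and an approximation on an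
`η`-dense subset is an `(ε + 2η)`-approximation after precomposing with a nearest-point
projection to `G`. We PROVE this elementary metric step in the vocabulary of the named fact
(`IsRoundSphereGHApprox`: distortion against the great-circle distance `∠` of `Sⁿ ⊂ ℝⁿ⁺¹` and
`ε`-density of the image, for Mathlib's length distance `d_h = Manifold.riemannianEDist` of the
`C^∞` Riemannian metric `h`).

Combined with relative volume comparison (`exists_mem_riemannianEDist_le_of_measure_compl_mul_lt`,
`BishopGromovVolumeComparison.lean` §6) this gives the form actually used: under `Ric ≥ n − 1` on a
closed `n`-manifold, an `ε`-approximation on a set `G` with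
`Vol(Gᶜ) · |Sⁿ| < Vol(M) · |S^{n-1}| ∫₀^η sin^{n-1}` yields an `(ε + 2η)`-approximation
(`exists_isRoundSphereGHApprox_of_measure_compl_mul_lt`).

No definitions, no named facts (D-0026).

## References

* T. H. Colding, *Shape of manifolds with positive Ricci curvature*, Invent. Math. 124 (1996),
  175–191, §2. [Colding1996Shape]
* T. H. Colding, *Aspects of Ricci curvature*, in: Comparison Geometry, MSRI Publ. 30 (1997),
  Def. 2.1, Thm. 2.2 (read: `lit read book:grove1997-comparison-geometry`, PDF pp. 114–115).
  [Colding1997Aspects]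
-/

noncomputable section

open Bundle Set Manifold InnerProductGeometry
open scoped Manifold ContDiff ENNReal

namespace Literature.Geometry.Riemannian

variable {n : ℕ} {M : Type} [TopologicalSpace M] [ChartedSpace (EuclideanSpace ℝ (Fin n)) M]
  [IsManifold (𝓡 n) ∞ M]

/-- **`ε`-approximations to the round sphere extend from `η`-dense subsets.** Let `h` be a `C^∞`
Riemannian metric on the connected `n`-manifold `M` (length distance `d_h = riemannianEDist`,
finite by connectedness), `G ⊆ M` an `η`-dense subset (`η ≥ 0`: every point is within `d_h ≤ η`
of `G`), and `f : M → Sⁿ` a map with `|∠(f a, f b) − d_h(a, b)| ≤ ε` for `a, b ∈ G` whose image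
of `G` is `ε`-dense in `(Sⁿ, ∠)`. Then there is `f' : M → Sⁿ`, equal to `f` on `G` (namely
`f ∘ ρ` for a nearest-point selection `ρ : M → G`, `ρ = id` on `G`), which is an
`(ε + 2η)`-approximation: `|∠(f' a, f' b) − d_h(a, b)| ≤ |∠(f ρa, f ρb) − d_h(ρa, ρb)| +
|d_h(ρa, ρb) − d_h(a, b)| ≤ ε + 2η` by the triangle inequality. (Colding 1997, proof of Thm. 2.2:
the map is an approximation off a set of small measure, dense by relative volume comparison.)
[cite: Colding1997Aspects, Def. 2.1 and proof of Thm. 2.2] [cite: Colding1996Shape, §2] -/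
theorem exists_isRoundSphereGHApprox_of_dense [PreconnectedSpace M]
    (h : ContMDiffRiemannianMetric (𝓡 n) ∞ (EuclideanSpace ℝ (Fin n))
      (TangentSpace (𝓡 n) : M → Type _))
    {G : Set M} {η ε : ℝ} (hη : 0 ≤ η)
    (hG : ∀ a : M, ∃ a' ∈ G, (letI : RiemannianBundle (fun x : M ↦ TangentSpace (𝓡 n) x) :=
        ⟨h.toContinuousRiemannianMetric.toRiemannianMetric⟩
      riemannianEDist (𝓡 n) a a') ≤ ENNReal.ofReal η)
    (f : M → Metric.sphere (0 : EuclideanSpace ℝ (Fin (n + 1))) 1)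
    (hdist : ∀ a ∈ G, ∀ b ∈ G,
      (letI : RiemannianBundle (fun x : M ↦ TangentSpace (𝓡 n) x) :=
        ⟨h.toContinuousRiemannianMetric.toRiemannianMetric⟩
      |angle (f a : EuclideanSpace ℝ (Fin (n + 1))) (f b) - (riemannianEDist (𝓡 n) a b).toReal|) ≤ ε)
    (hdense : ∀ y : Metric.sphere (0 : EuclideanSpace ℝ (Fin (n + 1))) 1, ∃ a ∈ G,
      angle (f a : EuclideanSpace ℝ (Fin (n + 1))) y ≤ ε) :
    ∃ f' : M → Metric.sphere (0 : EuclideanSpace ℝ (Fin (n + 1))) 1,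
      (∀ a ∈ G, f' a = f a) ∧ IsRoundSphereGHApprox n h (ε + 2 * η) f' := by
  classical
  letI : RiemannianBundle (fun x : M ↦ TangentSpace (𝓡 n) x) :=
    ⟨h.toContinuousRiemannianMetric.toRiemannianMetric⟩
  -- a nearest-point selection `ρ : M → G`, the identity on `G`
  choose pr hprG hpr using hG
  set ρ : M → M := fun a ↦ if a ∈ G then a else pr a with hρ_def
  have hρid : ∀ a ∈ G, ρ a = a := fun a ha ↦ by simp only [hρ_def, if_pos ha]
  have hρG : ∀ a, ρ a ∈ G := fun a ↦ by
    by_cases ha : a ∈ G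
    · rw [hρid a ha]; exact ha
    · have h' : ρ a = pr a := by simp only [hρ_def, if_neg ha]
      rw [h']; exact hprG a
  have hρd : ∀ a, riemannianEDist (𝓡 n) a (ρ a) ≤ ENNReal.ofReal η := fun a ↦ by
    by_cases ha : a ∈ G
    · rw [hρid a ha, riemannianEDist_self]; exact zero_le
    · have h' : ρ a = pr a := by simp only [hρ_def, if_neg ha]
      rw [h']; exact hpr a
  -- the real distance and its triangle inequality (finite by connectedness)
  have hfin : ∀ x y : M, riemannianEDist (𝓡 n) x y ≠ ⊤ := fun x y ↦
    riemannianEDist_ne_top (𝓡 n) x y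
  set d : M → M → ℝ := fun x y ↦ (riemannianEDist (𝓡 n) x y).toReal with hd_def
  have htri : ∀ x y z, d x z ≤ d x y + d y z := fun x y z ↦ by
    simp only [hd_def]
    rw [← ENNReal.toReal_add (hfin x y) (hfin y z)]
    exact ENNReal.toReal_mono (ENNReal.add_ne_top.2 ⟨hfin x y, hfin y z⟩)
      (riemannianEDist_triangle (I := 𝓡 n) (x := x) (y := y) (z := z))
  have hsymm : ∀ x y, d x y = d y x := fun x y ↦ by simp only [hd_def, riemannianEDist_comm]
  have hρη : ∀ x, d x (ρ x) ≤ η := fun x ↦ ENNReal.toReal_le_of_le_ofReal hη (hρd x)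
  refine ⟨fun a ↦ f (ρ a), fun a ha ↦ by show f (ρ a) = f a; rw [hρid a ha], ?_, ?_⟩
  · -- distortion: `|∠(f ρa, f ρb) − d(a, b)| ≤ ε + 2η`
    intro a b
    have h1 : |angle (f (ρ a) : EuclideanSpace ℝ (Fin (n + 1))) (f (ρ b)) - d (ρ a) (ρ b)| ≤ ε :=
      hdist (ρ a) (hρG a) (ρ b) (hρG b)
    have h2 : |d (ρ a) (ρ b) - d a b| ≤ 2 * η := by
      rw [abs_le]
      constructor
      · have h3 := htri a (ρ a) b
        have h4 := htri (ρ a) (ρ b) b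
        rw [hsymm (ρ b) b] at h4
        linarith [hρη a, hρη b]
      · have h3 := htri (ρ a) a (ρ b)
        have h4 := htri a b (ρ b)
        rw [hsymm (ρ a) a] at h3
        linarith [hρη a, hρη b]
    show |angle (f (ρ a) : EuclideanSpace ℝ (Fin (n + 1))) (f (ρ b)) - d a b| ≤ ε + 2 * η
    calc |angle (f (ρ a) : EuclideanSpace ℝ (Fin (n + 1))) (f (ρ b)) - d a b|
        ≤ |angle (f (ρ a) : EuclideanSpace ℝ (Fin (n + 1))) (f (ρ b)) - d (ρ a) (ρ b)| +
            |d (ρ a) (ρ b) - d a b| := abs_sub_le _ _ _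
      _ ≤ ε + 2 * η := add_le_add h1 h2
  · -- density of the image: already `f(G)` is `ε`-dense, and `f' = f` on `G`
    intro y
    obtain ⟨a, haG, ha⟩ := hdense y
    refine ⟨a, ?_⟩
    show angle (f (ρ a) : EuclideanSpace ℝ (Fin (n + 1))) y ≤ ε + 2 * η
    rw [hρid a haG]
    linarith

section Volume

open Literature.Geometry.Lorentzian (PseudoRiemannianMetric riemannianMeasure)

/-- **`ε`-approximations off a set of small measure are `(ε + 2η)`-approximations** (the use of
relative volume comparison at the end of Colding's Gromov–Hausdorff assembly, Colding 1997, proof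
of Thm. 2.2; in the binders of the named fact `Colding1996_volume_ghClose`): for `n ≥ 2`, a compact
connected `C^∞` Riemannian `n`-manifold `(M, h)` with `Ric_h ≥ (n − 1) h`, `0 < η ≤ π`, a set
`G ⊆ M` with `riemannianMeasure h Gᶜ · |Sⁿ| < riemannianMeasure h M · |S^{n-1}| ∫₀^η sin^{n-1}`
(so that `G` is `η`-dense, `exists_mem_riemannianEDist_le_of_measure_compl_mul_lt`), and
`f : M → Sⁿ` with distortion `≤ ε` on `G` and `f(G)` `ε`-dense, there is an
`(ε + 2η)`-approximation `M → Sⁿ` equal to `f` on `G` (`exists_isRoundSphereGHApprox_of_dense`).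
[cite: Colding1997Aspects, Def. 2.1 and proof of Thm. 2.2] [cite: Colding1996Shape, §2] -/
theorem exists_isRoundSphereGHApprox_of_measure_compl_mul_lt (n : ℕ) (hn : 2 ≤ n)
    (M : Type) [TopologicalSpace M] [T2Space M] [SecondCountableTopology M]
    [ChartedSpace (EuclideanSpace ℝ (Fin n)) M] [IsManifold (𝓡 n) ∞ M] [CompactSpace M]
    [ConnectedSpace M] [MeasurableSpace M] [BorelSpace M]
    (h : Bundle.ContMDiffRiemannianMetric (𝓡 n) ∞ (EuclideanSpace ℝ (Fin n))
      (TangentSpace (𝓡 n) : M → Type _))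
    [(PseudoRiemannianMetric.ofRiemannian h).HasLeviCivita]
    (hRic : ∀ (x : M) (v : TangentSpace (𝓡 n) x),
      ((n : ℝ) - 1) * h.inner x v v ≤ (PseudoRiemannianMetric.ofRiemannian h).ricci x v v)
    {G : Set M} {η ε : ℝ} (hη0 : 0 < η) (hηπ : η ≤ Real.pi)
    (hG : riemannianMeasure h Gᶜ * ENNReal.ofReal (unitSphereVolume n) <
      riemannianMeasure h Set.univ *
        ENNReal.ofReal (unitSphereVolume (n - 1) * ∫ t in (0:ℝ)..η, Real.sin t ^ (n - 1)))
    (f : M → Metric.sphere (0 : EuclideanSpace ℝ (Fin (n + 1))) 1)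
    (hdist : ∀ a ∈ G, ∀ b ∈ G,
      (letI : RiemannianBundle (fun x : M ↦ TangentSpace (𝓡 n) x) :=
        ⟨h.toContinuousRiemannianMetric.toRiemannianMetric⟩
      |angle (f a : EuclideanSpace ℝ (Fin (n + 1))) (f b) - (riemannianEDist (𝓡 n) a b).toReal|) ≤ ε)
    (hdense : ∀ y : Metric.sphere (0 : EuclideanSpace ℝ (Fin (n + 1))) 1, ∃ a ∈ G,
      angle (f a : EuclideanSpace ℝ (Fin (n + 1))) y ≤ ε) :
    ∃ f' : M → Metric.sphere (0 : EuclideanSpace ℝ (Fin (n + 1))) 1,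
      (∀ a ∈ G, f' a = f a) ∧ IsRoundSphereGHApprox n h (ε + 2 * η) f' :=
  exists_isRoundSphereGHApprox_of_dense h hη0.le
    (fun a ↦ exists_mem_riemannianEDist_le_of_measure_compl_mul_lt n hn M h hRic hη0 hηπ hG a)
    f hdist hdense

end Volume

end Literature.Geometry.Riemannian

end
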